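import Summits.BirchSwinnertonDyer.BirchSwinnertonDyer.Theorems.CyclotomicUntwistPSRankOneUpperHalfAtThreeOfSOED
import Summits.BirchSwinnertonDyer.BirchSwinnertonDyer.Theorems.CyclotomicUntwistPSRankOneLowerHalfAtThreeOfSOED
import HarnessLib

/-!
# Routes `CyclotomicUntwist` / `SemiOrdinaryEisensteinDescent` on the onto wild rank-one leaf, HALF BY HALF:
# `BSD₃(E)` row by row from the two half-kernels, the SOED kernel with its non-tower residual WEAKENED to the
# non-tower UPPER half, and CU's residual `WildSurjRankOneSupercuspidalAtThree` BY NAME (cross-route kernels)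

Cell `bsd-wall` (W-ALL, row 2 @3), prover seat `bsd-line-cycu-p3` (g0), 2026-08-27. HONEST FRAMING: CONDITIONAL
kernels — every crux named is an ANTECEDENT; closes nothing; BSD₃ for no curve; 0 definitions, 0 named facts, 0
`sorry`.

The companion files give, on the onto wild rank-one leaf (`ClassO6 W 3`, `ρ̄_{E,3}` onto, `r_an = 1`), the LOWER
half from SOED's {E, V, C, Z} on EVERY row (`lowerHalf_of_eisenstein_of_waldspurger_of_control_of_rankZeroLeaf`)
and the UPPER half from {Ko, Z} on the `3`-adic-tower-surjective rows
(`upperHalf_towerRows_of_kolyvaginCrux_of_rankZeroLeaf`). Here: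

* §1 `bsdp_of_soedHalves_of_nonTowerUpperHalf` — row kernel: published inputs ∧ E ∧ Ko ∧ V ∧ C ∧ Z ∧ «UPPER half
  on the non-tower rows» ⟹ `BSDp W 3` on every row of the leaf (`Typed.missingPPartAt_of_lower_of_upper`,
  `Typed.bsdp_of_missingPPartAt`).
* §2 **`wAllExclAddWildRankOneSurj_of_soed_of_nonTowerUpperHalf`** — the SOED kernel `EisensteinKernelAtThree`
  (item 20485, PROVED by bed-p3 g1) with its seventh antecedent `WildRankOneSurjNonTowerAtThree` (NT, item 20484:
  `BSD₃` on the non-tower rows, declared RESIDUAL) WEAKENED to the non-tower UPPER half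
  `∀ W, ¬CM → ClassO6 W 3 → ρ̄₃ onto → ¬TowerSurjThree W → r_an = 1 → MissingUpperBoundAt W 3`: the LOWER half of
  the non-tower rows is NOT residual — it is paid by E ∧ V ∧ C ∧ Z like every other row (none of E, V, C carries
  a tower binder). `nonTowerUpperHalf_of_nonTowerResidual` records that the weakened antecedent follows from NT
  (so item 20485's landed proof `semiOrdinaryEisensteinDescent_eisensteinKernelAtThree_proof` factors through §2).
* §3 `wildSurjRankOneSupercuspidalAtThree_of_soed_of_nonTowerUpperHalf` / `…_of_soed` — CU's declared residual
  `WildSurjRankOneSupercuspidalAtThree` (item 21582, «imported, not attacked») BY NAME from the SOED antecedents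
  (its supercuspidal binder is idle), so that with the companion files EVERY item of route `CyclotomicUntwist`
  has a typed supply from route `SemiOrdinaryEisensteinDescent`'s cruxes: K1 ⟸ {E, V, C, Z}, K2 ⟸ {Ko, Z, NT},
  residual ⟸ {E, Ko, V, C, Z, NT-upper}.

PLANNER-LEVEL READING (bookkeeping, not a ruling): SOED's NT can be restated as the non-tower UPPER half only
(Kolyvagin's Čebotarev step at level `3^M` is the tower-sensitive input; the Eisenstein side is tower-blind).
BSD is not proved by any of this.

References: [JetchevSkinnerWan2017] §7.4.1 (arXiv:1512.06894 p. 30); [GrossZagier1986] Thm. I.(6.3), (7.3);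
[Gross1991] Thm. 1.3; [Jetchev2008] Thm. 1.4; [Miller2011LMS] Def. 1.1.
-/

noncomputable section

open scoped Classical

set_option linter.dupNamespace false
set_option autoImplicit false

namespace Summit.BirchSwinnertonDyer.BirchSwinnertonDyer.Theorems.CyclotomicUntwistOfSOED

open WeierstrassCurve
  Literature.NumberTheory.EllipticCurves
  Literature.NumberTheory.EllipticCurves.Rank1Residual
  Literature.NumberTheory.EllipticCurves.Rank1Residual.Typed
  Summit.BirchSwinnertonDyer.Rank1Residual
  Summit.BirchSwinnertonDyer.Rank1Residual.Additive
  Summit.BirchSwinnertonDyer.BirchSwinnertonDyer.Theses.SemiOrdinaryEisensteinDescent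

/-- **The non-tower UPPER half** — the weakened form of SOED's residual `WildRankOneSurjNonTowerAtThree` that the
kernel actually consumes: on the onto wild rank-one rows whose `3`-adic tower is NOT surjective,
`ord₃ #Ш(E) ≤ ord₃ #Ш_an(E)`. Written out as a `∀`-statement (no new definition). It follows from NT
(`BSD₃` on those rows) by Miller's bookkeeping, `Ш` finite by Gross–Zagier–Kolyvagin. [cite: Miller2011LMS, Def. 1.1]
[cite: Jetchev2008, Thm. 1.4] -/
theorem nonTowerUpperHalf_of_nonTowerResidual (hGZK : rank_eq_analyticRank_of_analyticRank_le_one)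
    (hNT : WildRankOneSurjNonTowerAtThree) :
    ∀ (W : WeierstrassCurve ℚ) [W.IsElliptic] [W.IsGloballyMinimal],
      ¬ W.HasCM → ClassO6 W 3 → W.HasSurjectiveModNGaloisRep 3 → ¬ AdditiveThree.TowerSurjThree W →
      W.analyticRank = 1 → MissingUpperBoundAt W 3 := by
  intro W _ _ hncm hO6 hsurj htower hr
  exact missingUpperBoundAt_of_bsdp_of_gzk hGZK W 3 (by omega) (hNT W hncm hO6 hsurj htower hr)

/-! ### §1 `BSD₃(E)` row by row from the two half-kernels -/

/-- **Row kernel: `BSD₃(E)` on every onto wild rank-one row from SOED's {E, Ko, V, C, Z} and the non-tower UPPER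
half.** LOWER half from E ∧ V ∧ C ∧ Z on every row; UPPER half from Ko ∧ Z on the tower rows and from the displayed
hypothesis off them; the halves make Miller's last clause, and Gross–Zagier–Kolyvagin (`r_an = 1 ≤ 1`) makes
`BSDp W 3`. CONDITIONAL. [cite: JetchevSkinnerWan2017, §7.4.1 (arXiv:1512.06894 p. 30)] [cite: Miller2011LMS, Def. 1.1] -/
theorem bsdp_of_soedHalves_of_nonTowerUpperHalf (hF : PublishedInputsWildThree)
    (hE : WildSplitEisensteinInclusionAtThree) (hKoly : WildKolyvaginUpperAtThree)
    (hV : WildSplitWaldspurgerAtThree) (hC : WildSplitControlAtThree) (hZ : WildRankZeroTwistAtThree)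
    (hNTu : ∀ (W : WeierstrassCurve ℚ) [W.IsElliptic] [W.IsGloballyMinimal],
      ¬ W.HasCM → ClassO6 W 3 → W.HasSurjectiveModNGaloisRep 3 → ¬ AdditiveThree.TowerSurjThree W →
      W.analyticRank = 1 → MissingUpperBoundAt W 3)
    (W : WeierstrassCurve ℚ) [W.IsElliptic] [W.IsGloballyMinimal] (hncm : ¬ W.HasCM)
    (hO6 : ClassO6 W 3) (hsurj : W.HasSurjectiveModNGaloisRep 3) (hr : W.analyticRank = 1) :
    BSDp W 3 := by
  have hGZK : rank_eq_analyticRank_of_analyticRank_le_one := hF.2.2.1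
  have hlo : MissingLowerBoundAt W 3 :=
    lowerHalf_of_eisenstein_of_waldspurger_of_control_of_rankZeroLeaf hF hE hV hC hZ W hO6 hsurj hr
  have hup : MissingUpperBoundAt W 3 := by
    by_cases htower : AdditiveThree.TowerSurjThree W
    · exact upperHalf_towerRows_of_kolyvaginCrux_of_rankZeroLeaf hF hKoly hZ W hO6 hsurj htower hr
    · exact hNTu W hncm hO6 hsurj htower hr
  exact bsdp_of_missingPPartAt W 3 hGZK (by omega) (missingPPartAt_of_lower_of_upper W 3 hlo hup)

/-! ### §2 The SOED kernel with NT weakened to the non-tower UPPER half -/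

/-- **SOED's `EisensteinKernelAtThree` with its residual antecedent weakened:** published inputs →
`WildSplitEisensteinInclusionAtThree` → `WildKolyvaginUpperAtThree` → `WildSplitWaldspurgerAtThree` →
`WildSplitControlAtThree` → `WildRankZeroTwistAtThree` → «UPPER half on the non-tower rows» ⟹ the leaf
`WAllExclAddWildRankOneSurj`. Compared with item 20485 (which takes `WildRankOneSurjNonTowerAtThree` = `BSD₃` on the
non-tower rows), the LOWER half of the non-tower rows is discharged by the Eisenstein side. CONDITIONAL; closes
nothing; BSD is not proved by this. [cite: JetchevSkinnerWan2017, §7.4.1 (arXiv:1512.06894 p. 30)]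
[cite: GrossZagier1986, Thm. I.(6.3) and (7.3)] [cite: Jetchev2008, Thm. 1.4] -/
theorem wAllExclAddWildRankOneSurj_of_soed_of_nonTowerUpperHalf (hF : PublishedInputsWildThree)
    (hE : WildSplitEisensteinInclusionAtThree) (hKoly : WildKolyvaginUpperAtThree)
    (hV : WildSplitWaldspurgerAtThree) (hC : WildSplitControlAtThree) (hZ : WildRankZeroTwistAtThree)
    (hNTu : ∀ (W : WeierstrassCurve ℚ) [W.IsElliptic] [W.IsGloballyMinimal],
      ¬ W.HasCM → ClassO6 W 3 → W.HasSurjectiveModNGaloisRep 3 → ¬ AdditiveThree.TowerSurjThree W →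
      W.analyticRank = 1 → MissingUpperBoundAt W 3) :
    Summit.BirchSwinnertonDyer.WAllExclAddWildRankOneSurj := by
  intro W _ _ hncm hO6 hsurj hr
  exact bsdp_of_soedHalves_of_nonTowerUpperHalf hF hE hKoly hV hC hZ hNTu W hncm hO6 hsurj hr

/-! ### §3 Route `CyclotomicUntwist`, residual `WildSurjRankOneSupercuspidalAtThree` BY NAME -/

/-- **CU's residual `WildSurjRankOneSupercuspidalAtThree` (stmt-BirchSwinnertonDyer-21582: `BSD₃` on the
supercuspidal rows of the leaf) from SOED's {E, Ko, V, C, Z} and the non-tower UPPER half.** The supercuspidal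
binder `¬ (v₃(Δ_min) even ∧ Δ_min/3^v ≡ 1 (mod 3))` is idle. CONDITIONAL cross-route kernel; closes nothing.
[cite: JetchevSkinnerWan2017, §7.4.1 (arXiv:1512.06894 p. 30)] -/
theorem wildSurjRankOneSupercuspidalAtThree_of_soed_of_nonTowerUpperHalf (hF : PublishedInputsWildThree)
    (hE : WildSplitEisensteinInclusionAtThree) (hKoly : WildKolyvaginUpperAtThree)
    (hV : WildSplitWaldspurgerAtThree) (hC : WildSplitControlAtThree) (hZ : WildRankZeroTwistAtThree)
    (hNTu : ∀ (W : WeierstrassCurve ℚ) [W.IsElliptic] [W.IsGloballyMinimal],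
      ¬ W.HasCM → ClassO6 W 3 → W.HasSurjectiveModNGaloisRep 3 → ¬ AdditiveThree.TowerSurjThree W →
      W.analyticRank = 1 → MissingUpperBoundAt W 3) :
    Summit.BirchSwinnertonDyer.BirchSwinnertonDyer.Theses.CyclotomicUntwist.WildSurjRankOneSupercuspidalAtThree := by
  intro W _ _ hncm hO6 hsurj _hnotPS hr
  exact bsdp_of_soedHalves_of_nonTowerUpperHalf hF hE hKoly hV hC hZ hNTu W hncm hO6 hsurj hr

/-- **CU's residual BY NAME from the seven SOED antecedents verbatim** (NT in its filed form).
CONDITIONAL; closes nothing; BSD is not proved by this. [cite: JetchevSkinnerWan2017, §7.4.1] -/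
theorem wildSurjRankOneSupercuspidalAtThree_of_soed (hF : PublishedInputsWildThree)
    (hE : WildSplitEisensteinInclusionAtThree) (hKoly : WildKolyvaginUpperAtThree)
    (hV : WildSplitWaldspurgerAtThree) (hC : WildSplitControlAtThree) (hZ : WildRankZeroTwistAtThree)
    (hNT : WildRankOneSurjNonTowerAtThree) :
    Summit.BirchSwinnertonDyer.BirchSwinnertonDyer.Theses.CyclotomicUntwist.WildSurjRankOneSupercuspidalAtThree :=
  wildSurjRankOneSupercuspidalAtThree_of_soed_of_nonTowerUpperHalf hF hE hKoly hV hC hZ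
    (nonTowerUpperHalf_of_nonTowerResidual hF.2.2.1 hNT)

/-- **All three CU cruxes at once from the SOED antecedents** (K1 ∧ K2 ∧ residual), hence — by CU's own PROVED
deciding theorem `closes` with `PublishedInputGZK = hF.2.2.1` — the leaf again; recorded as the conjunction the
CU route file names (`PSRankOneLowerHalfAtThree ∧ PSRankOneUpperHalfAtThree ∧ WildSurjRankOneSupercuspidalAtThree`).
CONDITIONAL. [cite: JetchevSkinnerWan2017, §7.4.1] -/
theorem cyclotomicUntwist_cruxes_of_soed (hF : PublishedInputsWildThree)
    (hE : WildSplitEisensteinInclusionAtThree) (hKoly : WildKolyvaginUpperAtThree)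
    (hV : WildSplitWaldspurgerAtThree) (hC : WildSplitControlAtThree) (hZ : WildRankZeroTwistAtThree)
    (hNT : WildRankOneSurjNonTowerAtThree) :
    Summit.BirchSwinnertonDyer.BirchSwinnertonDyer.Theses.CyclotomicUntwist.PSRankOneLowerHalfAtThree ∧
    Summit.BirchSwinnertonDyer.BirchSwinnertonDyer.Theses.CyclotomicUntwist.PSRankOneUpperHalfAtThree ∧
    Summit.BirchSwinnertonDyer.BirchSwinnertonDyer.Theses.CyclotomicUntwist.WildSurjRankOneSupercuspidalAtThree :=
  ⟨psRankOneLowerHalfAtThree_of_soed hF hE hV hC hZ, psRankOneUpperHalfAtThree_of_soed hF hKoly hZ hNT,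
    wildSurjRankOneSupercuspidalAtThree_of_soed hF hE hKoly hV hC hZ hNT⟩

end Summit.BirchSwinnertonDyer.BirchSwinnertonDyer.Theorems.CyclotomicUntwistOfSOED

end
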